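import Mathlib
import HarnessLib
import Summits.FinalStateConjecture.FinalStateConjecture.Theses.ZeroEnergyKerrOrBomb
import Summits.FinalStateConjecture.FinalStateConjecture.Theorems.ZeroEnergyKerrOrBombKerrModeStabilityODE
import Summits.FinalStateConjecture.FinalStateConjecture.Theorems.ZeroEnergyKerrOrBombKerrModeStabilityLocalUniqueness
import Summits.FinalStateConjecture.FinalStateConjecture.Theorems.ZeroEnergyKerrOrBombKerrModeStabilityRestrict
import Summits.FinalStateConjecture.FinalStateConjecture.Theorems.ZeroEnergyKerrOrBombKerrModeStabilityLeaf
import Summits.FinalStateConjecture.FinalStateConjecture.Theorems.ZeroEnergyKerrOrBombKerrModeStabilityTruncated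
import Summits.FinalStateConjecture.FinalStateConjecture.Theorems.ZeroEnergyKerrOrBombKerrModeStabilityEnergy
import Summits.FinalStateConjecture.FinalStateConjecture.Theorems.ZeroEnergyKerrOrBombKerrModeStabilityGrowth
import Literature.Geometry.Lorentzian.KerrHorizonRegularWaveBoundedness

/-!
# Route ZeroEnergyKerrOrBomb · item `KerrModeStability` — mode stability of subextremal Kerr from
# the boundedness theorem of Dafermos–Rodnianski–Shlapentokh-Rothman

This file proves the route statement `KerrModeStability` (item stmt-FinalStateConjecture-10024:
no exponentially growing Killing-mode pair of `□_g`, smooth across `𝓗⁺` and bounded on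
`{r > r₊, t* ≤ 0}`, on a subextremal Kerr exterior — Whiting 1989 / Shlapentokh-Rothman 2015 in the
route's typing) **conditionally** on two named facts of the Literature:

* `DafermosRodnianskiShlapentokhRothman2016_energyBoundedness_horizonRegular` — Theorem 3.1 (23)
  of arXiv:1402.7034 in its §3.3 form, for the printed (horizon-regular) class of solutions;
* `KerrSchild.waveCauchyProblem` — existence for the Cauchy problem of the wave equation on a
  generalised Kerr–Schild background (Bär–Ginoux–Pfäffle 2007, Thm. 3.2.11).

Argument (`kerrModeStability_of`). By `kerrModePair_eq_zero_of_slice` it suffices to show that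
the pair vanishes at every exterior slice point `p`. If not, the summed coordinate energy density
`e = e_ψ + e_χ` is `≥ m > 0` on a ball `B` of exterior slice points around `p⃗`
(`kerrModePair_local_energy_pos`). For `n ∈ ℕ` let `ψ_n, χ_n` be the solutions launched from the
data of `ψ, χ` truncated at radius `R₀ = ‖p⃗‖ + δ₀ + n + 2` (`kerrMode_truncatedSolution_exists`). By
local uniqueness (`kerr_local_uniqueness_two`) they agree with `ψ, χ` over `B` at time `n`, where
the density of the pair is `e^{2νn} e` (`kerrModePair_coordEnergyDensity_timeShift`), so
`e^{2νn} m vol(B) ≤ E[ψ_n](n) + E[χ_n](n)`; by the DRSR fact (through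
`kerr_leafEnergy_boundedness_of`) this is `≤ C (E[ψ_n](0) + E[χ_n](0))`, and the initial energies
are `≤ 2·(energy of ψ, χ in the ball of radius R₀ + 1) + O(R₀³)` (bounded data), which grows only
like `R₀³` because the pair is bounded on `{t* ≤ 0}` (`kerrModePair_sliceEnergy_growth`, the
Lagrangian identity). An exponential cannot be bounded by a cubic (`kerr_exp_le_cubic_false`).
-/

noncomputable section

namespace Summit.FinalStateConjecture.FinalStateConjecture.Theorems

open Literature.Geometry.Lorentzian Set Filter MeasureTheory
open scoped Manifold ContDiff Topology ENNReal

-- every `Summit.FinalStateConjecture.FinalStateConjecture.…` name repeats the summit = sub-problem segment (D-0017 layout)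
set_option linter.dupNamespace false

/-- **An exponential is not bounded by a cubic**: if `l > 0`, `κ > 0` and
`e^{κ n} l ≤ α (n + β)³ + γ` for all `n ∈ ℕ` with `α, β, γ ≥ 0`, contradiction
(`e^{x} ≥ x⁴/24`). -/
theorem kerr_exp_le_cubic_false {l κ α β γ : ℝ} (hl : 0 < l) (hκ : 0 < κ) (hα : 0 ≤ α)
    (hβ : 0 ≤ β) (hγ : 0 ≤ γ) (h : ∀ n : ℕ, Real.exp (κ * n) * l ≤ α * (n + β) ^ 3 + γ) :
    False := by
  -- for `n ≥ max β 1`: `l κ⁴ n⁴ / 24 ≤ (8α + γ) n³`, i.e. `l κ⁴ n / 24 ≤ 8α + γ`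
  have hbig : ∀ n : ℕ, β ≤ n → 1 ≤ (n : ℝ) → l * κ ^ 4 * n / 24 ≤ 8 * α + γ := by
    intro n hnβ hn1
    have hn0 : 0 < (n : ℝ) := by linarith
    have hexp : (κ * n) ^ 4 / 24 ≤ Real.exp (κ * n) := by
      have := Real.pow_div_factorial_le_exp (x := κ * n) (by positivity) 4
      norm_num [Nat.factorial] at this
      exact this
    have h1 : (κ * n) ^ 4 / 24 * l ≤ α * (n + β) ^ 3 + γ :=
      (mul_le_mul_of_nonneg_right hexp hl.le).trans (h n)
    have h2 : α * (n + β) ^ 3 ≤ α * (2 * n) ^ 3 := by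
      gcongr; linarith
    have h3 : γ ≤ γ * n ^ 3 := by
      have : (1 : ℝ) ≤ n ^ 3 := one_le_pow₀ hn1
      nlinarith
    have h4 : (κ * n) ^ 4 / 24 * l ≤ (8 * α + γ) * n ^ 3 := by nlinarith
    have h5 : (κ * n) ^ 4 / 24 * l = (l * κ ^ 4 * n / 24) * n ^ 3 := by ring
    rw [h5] at h4
    exact le_of_mul_le_mul_right h4 (by positivity)
  obtain ⟨n, hn⟩ := exists_nat_gt (max (max β 1) (24 * (8 * α + γ + 1) / (l * κ ^ 4)))
  have hnβ : β ≤ n := ((le_max_left _ _).trans (le_max_left _ _)).trans hn.le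
  have hn1 : (1 : ℝ) ≤ n := ((le_max_right _ _).trans (le_max_left _ _)).trans hn.le
  have hq : 24 * (8 * α + γ + 1) / (l * κ ^ 4) < n := (le_max_right _ _).trans_lt hn
  have hpos : 0 < l * κ ^ 4 := by positivity
  rw [div_lt_iff₀ hpos] at hq
  have := hbig n hnβ hn1
  nlinarith

/-- `(0, y) + t ∂_{t*} = (t, y)`. -/
theorem kerr_ofTimeSpace_zero_add_smul (t : ℝ) (y : E3) :
    E4.ofTimeSpace 0 y + t • E4.basisVector 0 = E4.ofTimeSpace t y := by
  rw [E4.ofTimeSpace_eq_smul_add' t y, E4.ofTimeSpace_eq_smul_add' 0 y, zero_smul, zero_add,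
    add_comm]

/-- **Mode stability of subextremal Kerr, from DRSR boundedness and the Cauchy problem** (item
`KerrModeStability` of route ZeroEnergyKerrOrBomb, conditional form): assuming the named facts
`DafermosRodnianskiShlapentokhRothman2016_energyBoundedness_horizonRegular` (arXiv:1402.7034,
Thm. 3.1 (23), §3.3, horizon-regular class) and `KerrSchild.waveCauchyProblem` (Bär–Ginoux–Pfäffle
2007, Thm. 3.2.11), there is no non-trivial Killing-mode pair `(ψ, χ)` of `□_g` with `ν > 0` on the
horizon-penetrating chart `Kerr.region a r₀` (`r₋ < r₀ < r₊`, `|a| < M`) which is bounded on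
`{r > r₊, t* ≤ 0}`. See the module docstring for the argument (Whiting 1989; Shlapentokh-Rothman,
AHP 16 (2015), Thm. 1.5; Dafermos–Rodnianski–Shlapentokh-Rothman, Ann. of Math. 183 (2016)). -/
theorem kerrModeStability_of
    (hA : Literature.Geometry.Lorentzian.DafermosRodnianskiShlapentokhRothman2016_energyBoundedness_horizonRegular)
    (hwcp : Literature.Geometry.Lorentzian.KerrSchild.waveCauchyProblem) :
    Summit.FinalStateConjecture.FinalStateConjecture.Theses.ZeroEnergyKerrOrBomb.KerrModeStability := by
  intro instF instS M a r₀ hMa hrm hr ν w ψ χ hν hψ hχ H hbdd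
  classical
  have heig : ∀ x : Kerr.region a r₀, Kerr.rPlus M a < Kerr.radius a x.1 →
      mfderiv 𝓘(ℝ, E4) 𝓘(ℝ, ℝ) ψ x (Kerr.stationaryField a r₀ x) = ν * ψ x - w * χ x ∧
      mfderiv 𝓘(ℝ, E4) 𝓘(ℝ, ℝ) χ x (Kerr.stationaryField a r₀ x) = w * ψ x + ν * χ x :=
    fun x hx ↦ ⟨(H x hx).2.2.1, (H x hx).2.2.2⟩
  have hsolψ : ∀ x : Kerr.region a r₀, Kerr.rPlus M a < Kerr.radius a x.1 →
      (Kerr.smoothMetric M a r₀).toPseudoRiemannianMetric.dalembertian ψ x = 0 :=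
    fun x hx ↦ (H x hx).1
  have hsolχ : ∀ x : Kerr.region a r₀, Kerr.rPlus M a < Kerr.radius a x.1 →
      (Kerr.smoothMetric M a r₀).toPseudoRiemannianMetric.dalembertian χ x = 0 :=
    fun x hx ↦ (H x hx).2.1
  refine kerrModePair_eq_zero_of_slice hψ hχ heig (fun p hp hp0 ↦ ?_)
  by_contra hne
  -- ### constants
  obtain ⟨Cb, hCb⟩ := hbdd
  obtain ⟨K, hK0, hK⟩ := Kerr.exists_bound_deriv_smoothTransition
  obtain ⟨C, hC, hleaf⟩ := kerr_leafEnergy_boundedness_of hA hMa hrm hr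
  obtain ⟨A, B, hA0, hB0, hgrowth⟩ := kerrModePair_sliceEnergy_growth hMa hrm hr hψ hχ H hCb
  obtain ⟨δ₀, m, hδ₀, hm, hball⟩ :=
    kerrModePair_local_energy_pos hν hψ hχ heig p hp hp0 hne
  have hCb0 : 0 ≤ Cb := (abs_nonneg _).trans (hCb p hp hp0.le).1
  set rp := Kerr.rPlus M a with hrp_def
  set Φ : E4 → ℝ := Function.extend Subtype.val ψ 0 with hΦ_def
  set X : E4 → ℝ := Function.extend Subtype.val χ 0 with hX_def
  set y₀ : E3 := E4.spatial (p : E4) with hy₀_def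
  set Bset : Set E3 := Metric.ball y₀ δ₀ with hBset
  set Sext : Set E3 := {y : E3 | E4.ofTimeSpace 0 y ∈ Kerr.exterior M a} with hSext
  set e : E3 → ℝ := fun y ↦ coordEnergyDensity (Kerr.region a r₀) ψ (E4.ofTimeSpace 0 y) +
    coordEnergyDensity (Kerr.region a r₀) χ (E4.ofTimeSpace 0 y) with he_def
  have he0 : ∀ y, 0 ≤ e y := fun y ↦
    add_nonneg (coordEnergyDensity_nonneg _ _ _) (coordEnergyDensity_nonneg _ _ _)
  set J₁ : ℝ := 6 * K ^ 2 * Cb ^ 2 + (|ν| * Cb + |w| * Cb) ^ 2 with hJ₁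
  have hJ₁0 : 0 ≤ J₁ := by positivity
  -- the volume scale
  set V₁ : ℝ≥0∞ := volume (Metric.ball (0 : E3) 1) with hV₁
  have hV₁top : V₁ < ⊤ := measure_ball_lt_top
  have hvolcb : ∀ R : ℝ, 0 ≤ R → volume (Metric.closedBall (0 : E3) R) = ENNReal.ofReal (R ^ 3) * V₁ := by
    intro R hR
    rw [Measure.addHaar_closedBall volume (0 : E3) hR, finrank_euclideanSpace_fin]
  -- the lower bound constant
  set L : ℝ≥0∞ := ENNReal.ofReal m * volume Bset with hL
  have hLpos : 0 < L := ENNReal.mul_pos (by simpa using hm) (Metric.measure_ball_pos volume y₀ hδ₀).ne'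
  have hLtop : L < ⊤ := ENNReal.mul_lt_top (by simp) measure_ball_lt_top
  have hLint : L ≤ ∫⁻ y in Bset, ENNReal.ofReal (e y) := by
    calc L = ∫⁻ _ in Bset, ENNReal.ofReal m := (setLIntegral_const _ _).symm
      _ ≤ ∫⁻ y in Bset, ENNReal.ofReal (e y) :=
          setLIntegral_mono' measurableSet_ball fun y hy ↦ ENNReal.ofReal_le_ofReal (hball y hy).2
  -- bounds of the pair on the slice
  have hΦb : ∀ y : E3, rp < Kerr.radius a (E4.ofTimeSpace 0 y) →
      |Φ (E4.ofTimeSpace 0 y)| ≤ Cb ∧ |X (E4.ofTimeSpace 0 y)| ≤ Cb := by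
    intro y hy
    have h := hCb ⟨E4.ofTimeSpace 0 y, kerr_mem_region_of_rPlus_lt hMa hr.le hy⟩ hy (by simp)
    rwa [extend_rep ψ, extend_rep χ] at h
  -- ### the estimate at each integer time
  have key : ∀ n : ℕ, ENNReal.ofReal (Real.exp (2 * ν * n)) * L ≤
      C * (2 * (2 * ENNReal.ofReal (A * (‖y₀‖ + δ₀ + n + 3) ^ 3 + B) +
        ENNReal.ofReal J₁ * (ENNReal.ofReal ((‖y₀‖ + δ₀ + n + 3) ^ 3) * V₁))) := by
    intro n
    set τ : ℝ := (n : ℝ) with hτ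
    have hτ0 : 0 ≤ τ := by positivity
    set R₀ : ℝ := ‖y₀‖ + δ₀ + n + 2 with hR₀
    have hR₀pos : 0 < R₀ := by rw [hR₀]; positivity
    have hR₀1 : R₀ + 1 = ‖y₀‖ + δ₀ + n + 3 := by rw [hR₀]; ring
    have hR₀10 : 0 ≤ R₀ + 1 := by linarith
    -- the truncated solutions
    obtain ⟨ψt, hψt, hsolt, hfart, hagreet, hdenst, hzerot⟩ :=
      kerrMode_truncatedSolution_exists hwcp hMa hrm hr hψ hχ (ν := ν) (w := w)
        (fun x hx ↦ (heig x hx).1) hR₀pos hK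
    obtain ⟨χt, hχt, hsolct, hfarct, hagreect, hdensct, hzeroct⟩ :=
      kerrMode_truncatedSolution_exists hwcp hMa hrm hr hχ hψ (ν := ν) (w := -w)
        (fun x hx ↦ by rw [(heig x hx).2]; ring) hR₀pos hK
    set ψt' : Kerr.exterior M a → ℝ :=
      fun y : Kerr.exterior M a ↦ ψt ⟨(y : E4), Kerr.region_mono a hr.le y.2⟩ with hψt'
    set χt' : Kerr.exterior M a → ℝ :=
      fun y : Kerr.exterior M a ↦ χt ⟨(y : E4), Kerr.region_mono a hr.le y.2⟩ with hχt'
    -- DRSR boundedness for the truncated solutions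
    have hEψ : sliceEnergy (Kerr.exterior M a) ψt' τ ≤ C * sliceEnergy (Kerr.exterior M a) ψt' 0 :=
      hleaf ψt hψt (fun x _ ↦ hsolt x) hfart τ hτ0
    have hEχ : sliceEnergy (Kerr.exterior M a) χt' τ ≤ C * sliceEnergy (Kerr.exterior M a) χt' 0 :=
      hleaf χt hχt (fun x _ ↦ hsolct x) hfarct τ hτ0
    -- ### lower bound at time `τ = n`: the truncated solutions are the pair over the ball
    have hBU : ∀ y ∈ Bset, E4.ofTimeSpace τ y ∈ Kerr.exterior M a := fun y hy ↦
      kerr_mem_exterior_of_rPlus_lt hMa (by rw [Kerr.radius_ofTimeSpace, ← Kerr.radius_ofTimeSpace a 0]; exact (hball y hy).1)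
    have hagree_at : ∀ (f : Kerr.region a r₀ → ℝ) (ft : Kerr.region a r₀ → ℝ),
        ContMDiff 𝓘(ℝ, E4) 𝓘(ℝ, ℝ) ∞ ft → ContMDiff 𝓘(ℝ, E4) 𝓘(ℝ, ℝ) ∞ f →
        (∀ x, (Kerr.smoothMetric M a r₀).toPseudoRiemannianMetric.dalembertian ft x = 0) →
        (∀ x : Kerr.region a r₀, Kerr.rPlus M a < Kerr.radius a x.1 →
          (Kerr.smoothMetric M a r₀).toPseudoRiemannianMetric.dalembertian f x = 0) →
        (∀ y : E3, Kerr.rPlus M a < Kerr.radius a (E4.ofTimeSpace 0 y) → ‖y‖ ≤ R₀ →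
          Function.extend Subtype.val ft 0 (E4.ofTimeSpace 0 y) =
              Function.extend Subtype.val f 0 (E4.ofTimeSpace 0 y) ∧
            fderiv ℝ (Function.extend Subtype.val ft 0) (E4.ofTimeSpace 0 y) (E4.basisVector 0) =
              fderiv ℝ (Function.extend Subtype.val f 0) (E4.ofTimeSpace 0 y) (E4.basisVector 0)) →
        ∀ y ∈ Bset, coordEnergyDensity (Kerr.exterior M a)
            (fun z : Kerr.exterior M a ↦ ft ⟨(z : E4), Kerr.region_mono a hr.le z.2⟩)
            (E4.ofTimeSpace τ y) =
          coordEnergyDensity (Kerr.region a r₀) f (E4.ofTimeSpace τ y) := by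
      intro f ft hft hf hsolft hsolf hag y hy
      have hq : E4.ofTimeSpace τ y ∈ Kerr.exterior M a := hBU y hy
      have hqr : Kerr.rPlus M a < Kerr.radius a (E4.ofTimeSpace τ y) :=
        kerr_rPlus_lt_of_mem_exterior hMa hq
      rw [kerr_coordEnergyDensity_restrict hr.le ft hq]
      have hyy₀ : ‖y - y₀‖ < δ₀ := by rwa [← dist_eq_norm]
      have hnorm : ∀ y' : E3, ‖y' - y‖ < τ + 1 → ‖y'‖ ≤ R₀ := by
        intro y' hdist
        have h1 : ‖y'‖ ≤ ‖y' - y‖ + ‖y - y₀‖ + ‖y₀‖ := by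
          calc ‖y'‖ = ‖(y' - y) + (y - y₀) + y₀‖ := by abel_nf
            _ ≤ ‖(y' - y) + (y - y₀)‖ + ‖y₀‖ := norm_add_le _ _
            _ ≤ ‖y' - y‖ + ‖y - y₀‖ + ‖y₀‖ := by gcongr; exact norm_add_le _ _
        rw [hR₀]; linarith
      obtain ⟨-, hfd⟩ := kerr_local_uniqueness_two hMa hr.le hft hf (fun x _ ↦ hsolft x) hsolf
        (y₀ := y) (R₀ := τ + 1)
        (fun y' hy' hdist ↦ (hag y' hy' (hnorm y' hdist)).1)
        (fun y' hy' hdist ↦ (hag y' hy' (hnorm y' hdist)).2)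
        (x := E4.ofTimeSpace τ y) hqr
        (show 0 ≤ (E4.ofTimeSpace τ y) 0 by rw [E4.ofTimeSpace_apply_zero]; exact hτ0)
        (show (E4.ofTimeSpace τ y) 0 < τ + 1 by rw [E4.ofTimeSpace_apply_zero]; linarith)
        (E4.spatial_ofTimeSpace τ y)
      simp only [coordEnergyDensity, hfd]
    have hsum : ∀ y ∈ Bset,
        ENNReal.ofReal (coordEnergyDensity (Kerr.exterior M a) ψt' (E4.ofTimeSpace τ y)) +
          ENNReal.ofReal (coordEnergyDensity (Kerr.exterior M a) χt' (E4.ofTimeSpace τ y)) =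
        ENNReal.ofReal (Real.exp (2 * ν * τ)) * ENNReal.ofReal (e y) := by
      intro y hy
      rw [hψt', hagree_at ψ ψt hψt hψ hsolt hsolψ hagreet y hy,
        hχt', hagree_at χ χt hχt hχ hsolct hsolχ hagreect y hy,
        ← ENNReal.ofReal_add (coordEnergyDensity_nonneg _ _ _) (coordEnergyDensity_nonneg _ _ _),
        ← ENNReal.ofReal_mul (Real.exp_pos _).le]
      congr 1
      have hyreg : E4.ofTimeSpace 0 y ∈ Kerr.region a r₀ :=
        kerr_mem_region_of_rPlus_lt hMa hr.le (hball y hy).1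
      have h := kerrModePair_coordEnergyDensity_timeShift hψ hχ heig ⟨E4.ofTimeSpace 0 y, hyreg⟩
        (hball y hy).1 τ
      rw [show ((⟨E4.ofTimeSpace 0 y, hyreg⟩ : Kerr.region a r₀) : E4) + τ • E4.basisVector 0 =
        E4.ofTimeSpace τ y from kerr_ofTimeSpace_zero_add_smul τ y] at h
      exact h
    have hlow : ENNReal.ofReal (Real.exp (2 * ν * τ)) * L ≤
        sliceEnergy (Kerr.exterior M a) ψt' τ + sliceEnergy (Kerr.exterior M a) χt' τ :=
      (mul_le_mul' le_rfl hLint).trans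
        (kerr_setLIntegral_le_sliceEnergy_add (Kerr.exterior M a) ψt' χt' τ measurableSet_ball hBU
          ENNReal.ofReal_ne_top (fun y ↦ ENNReal.ofReal (e y)) hsum)
    -- ### upper bound at time `0`
    have hup : ∀ (f g : Kerr.region a r₀ → ℝ) (ft : Kerr.region a r₀ → ℝ) (c₁ c₂ : ℝ),
        (∀ y : E3, rp < Kerr.radius a (E4.ofTimeSpace 0 y) →
          |Function.extend Subtype.val f 0 (E4.ofTimeSpace 0 y)| ≤ Cb ∧
          |Function.extend Subtype.val g 0 (E4.ofTimeSpace 0 y)| ≤ Cb) →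
        (∀ y, coordEnergyDensity (Kerr.region a r₀) f (E4.ofTimeSpace 0 y) ≤ e y) →
        |c₁| = |ν| → |c₂| = |w| →
        (∀ y : E3, Kerr.rPlus M a < Kerr.radius a (E4.ofTimeSpace 0 y) →
          coordEnergyDensity (Kerr.region a r₀) ft (E4.ofTimeSpace 0 y) ≤
            2 * coordEnergyDensity (Kerr.region a r₀) f (E4.ofTimeSpace 0 y) +
              (6 * K ^ 2 * (Function.extend Subtype.val f 0 (E4.ofTimeSpace 0 y)) ^ 2 +
                (|c₁| * |Function.extend Subtype.val f 0 (E4.ofTimeSpace 0 y)| +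
                  |c₂| * |Function.extend Subtype.val g 0 (E4.ofTimeSpace 0 y)|) ^ 2)) →
        (∀ y : E3, R₀ + 1 < ‖y‖ → E4.ofTimeSpace 0 y ∈ Kerr.region a r₀ →
          coordEnergyDensity (Kerr.region a r₀) ft (E4.ofTimeSpace 0 y) = 0) →
        sliceEnergy (Kerr.exterior M a)
            (fun z : Kerr.exterior M a ↦ ft ⟨(z : E4), Kerr.region_mono a hr.le z.2⟩) 0 ≤
          2 * ENNReal.ofReal (A * (R₀ + 1) ^ 3 + B) +
            ENNReal.ofReal J₁ * (ENNReal.ofReal ((R₀ + 1) ^ 3) * V₁) := by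
      intro f g ft c₁ c₂ hfg hfe hc₁ hc₂ hdens hzero
      have h1 := kerr_sliceEnergy_le_setLIntegral_closedBall (Kerr.exterior M a)
        (fun z : Kerr.exterior M a ↦ ft ⟨(z : E4), Kerr.region_mono a hr.le z.2⟩) 0 (R₀ + 1)
        (fun y ↦ 2 * coordEnergyDensity (Kerr.region a r₀) f (E4.ofTimeSpace 0 y) + J₁)
        (fun y hyU hyR ↦ by
          rw [kerr_coordEnergyDensity_restrict hr.le ft hyU]
          exact hzero y hyR (Kerr.region_mono a hr.le hyU))
        (fun y hyU _ ↦ by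
          rw [kerr_coordEnergyDensity_restrict hr.le ft hyU]
          have hyr := kerr_rPlus_lt_of_mem_exterior hMa hyU
          refine (hdens y hyr).trans (add_le_add le_rfl ?_)
          obtain ⟨hfb, hgb⟩ := hfg y hyr
          have hsq : (Function.extend Subtype.val f 0 (E4.ofTimeSpace 0 y)) ^ 2 ≤ Cb ^ 2 := by
            rw [← sq_abs]; exact pow_le_pow_left₀ (abs_nonneg _) hfb 2
          have hlin : |c₁| * |Function.extend Subtype.val f 0 (E4.ofTimeSpace 0 y)| +
              |c₂| * |Function.extend Subtype.val g 0 (E4.ofTimeSpace 0 y)| ≤ |ν| * Cb + |w| * Cb := by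
            rw [hc₁, hc₂]
            gcongr
          have hlin' : (|c₁| * |Function.extend Subtype.val f 0 (E4.ofTimeSpace 0 y)| +
              |c₂| * |Function.extend Subtype.val g 0 (E4.ofTimeSpace 0 y)|) ^ 2 ≤
              (|ν| * Cb + |w| * Cb) ^ 2 := pow_le_pow_left₀ (by positivity) hlin 2
          rw [hJ₁]
          nlinarith [sq_nonneg K])
      refine h1.trans ?_
      have h2 := kerr_setLIntegral_indicator_two_mul_add_le Sext
        (fun y ↦ coordEnergyDensity (Kerr.region a r₀) f (E4.ofTimeSpace 0 y))
        (fun y ↦ coordEnergyDensity_nonneg _ _ _) hJ₁0 (R₀ + 1)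
      refine h2.trans ?_
      rw [hvolcb (R₀ + 1) hR₀10]
      gcongr 2 * ?_ + _
      refine le_trans ?_ (hgrowth (R₀ + 1) hR₀10)
      refine lintegral_mono fun y ↦ ?_
      by_cases hy : y ∈ Sext
      · have hy' : y ∈ {y : E3 | Kerr.rPlus M a < Kerr.radius a (E4.ofTimeSpace 0 y)} :=
          kerr_rPlus_lt_of_mem_exterior hMa hy
        rw [Set.indicator_of_mem hy, Set.indicator_of_mem hy']
        exact ENNReal.ofReal_le_ofReal (hfe y)
      · rw [Set.indicator_of_notMem hy]; exact bot_le
    have hupψ := hup ψ χ ψt ν w hΦb (fun y ↦ le_add_of_nonneg_right (coordEnergyDensity_nonneg _ _ _))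
      rfl rfl hdenst hzerot
    have hupχ := hup χ ψ χt ν (-w) (fun y hy ↦ ⟨(hΦb y hy).2, (hΦb y hy).1⟩)
      (fun y ↦ le_add_of_nonneg_left (coordEnergyDensity_nonneg _ _ _)) rfl (abs_neg w) hdensct hzeroct
    -- ### chain
    calc ENNReal.ofReal (Real.exp (2 * ν * n)) * L
        ≤ sliceEnergy (Kerr.exterior M a) ψt' τ + sliceEnergy (Kerr.exterior M a) χt' τ := hlow
      _ ≤ C * sliceEnergy (Kerr.exterior M a) ψt' 0 + C * sliceEnergy (Kerr.exterior M a) χt' 0 :=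
          add_le_add hEψ hEχ
      _ = C * (sliceEnergy (Kerr.exterior M a) ψt' 0 + sliceEnergy (Kerr.exterior M a) χt' 0) := by
          rw [mul_add]
      _ ≤ C * (2 * (2 * ENNReal.ofReal (A * (R₀ + 1) ^ 3 + B) +
            ENNReal.ofReal J₁ * (ENNReal.ofReal ((R₀ + 1) ^ 3) * V₁))) := by
          gcongr
          rw [two_mul]
          exact add_le_add hupψ hupχ
      _ = _ := by rw [hR₀1]
  -- ### conclusion: pass to real numbers
  set l : ℝ := L.toReal with hl
  have hl0 : 0 < l := ENNReal.toReal_pos hLpos.ne' hLtop.ne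
  set c : ℝ := C.toReal with hc
  set v₁ : ℝ := V₁.toReal with hv₁
  have hc0 : 0 ≤ c := ENNReal.toReal_nonneg
  have hv₁0 : 0 ≤ v₁ := ENNReal.toReal_nonneg
  set β : ℝ := ‖y₀‖ + δ₀ + 3 with hβ
  have hβ0 : 0 ≤ β := by positivity
  have hreal : ∀ n : ℕ, Real.exp (2 * ν * n) * l ≤
      (c * (4 * A + 2 * J₁ * v₁)) * (n + β) ^ 3 + c * (4 * B) := by
    intro n
    have hk := key n
    have hP0 : 0 ≤ A * (‖y₀‖ + δ₀ + n + 3) ^ 3 + B := by positivity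
    have hRHS : C * (2 * (2 * ENNReal.ofReal (A * (‖y₀‖ + δ₀ + n + 3) ^ 3 + B) +
        ENNReal.ofReal J₁ * (ENNReal.ofReal ((‖y₀‖ + δ₀ + n + 3) ^ 3) * V₁))) =
        ENNReal.ofReal (c * (2 * (2 * (A * (‖y₀‖ + δ₀ + n + 3) ^ 3 + B) +
          J₁ * ((‖y₀‖ + δ₀ + n + 3) ^ 3 * v₁)))) := by
      have hQ0 : 0 ≤ (‖y₀‖ + δ₀ + n + 3) ^ 3 := by positivity
      rw [← ENNReal.ofReal_toReal hC.ne, ← ENNReal.ofReal_toReal hV₁top.ne, ← hc, ← hv₁]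
      rw [ENNReal.ofReal_mul hc0, ENNReal.ofReal_mul (by norm_num : (0:ℝ) ≤ 2),
        ENNReal.ofReal_add (p := 2 * (A * (‖y₀‖ + δ₀ + n + 3) ^ 3 + B)) (by positivity)
          (by positivity),
        ENNReal.ofReal_mul (by norm_num : (0:ℝ) ≤ 2), ENNReal.ofReal_mul hJ₁0,
        ENNReal.ofReal_mul hQ0, ENNReal.ofReal_ofNat]
    have hLHS : ENNReal.ofReal (Real.exp (2 * ν * n)) * L =
        ENNReal.ofReal (Real.exp (2 * ν * n) * l) := by
      rw [hl, ENNReal.ofReal_mul (Real.exp_pos _).le, ENNReal.ofReal_toReal hLtop.ne]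
    rw [hRHS, hLHS] at hk
    have hk' := (ENNReal.ofReal_le_ofReal_iff (by positivity)).mp hk
    have : c * (2 * (2 * (A * (‖y₀‖ + δ₀ + n + 3) ^ 3 + B) + J₁ * ((‖y₀‖ + δ₀ + n + 3) ^ 3 * v₁))) =
        (c * (4 * A + 2 * J₁ * v₁)) * (n + β) ^ 3 + c * (4 * B) := by rw [hβ]; ring
    linarith
  have hα0 : 0 ≤ c * (4 * A + 2 * J₁ * v₁) := by positivity
  have hγ0 : 0 ≤ c * (4 * B) := by positivity
  exact kerr_exp_le_cubic_false (κ := 2 * ν) (α := c * (4 * A + 2 * J₁ * v₁)) (β := β)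
    (γ := c * (4 * B)) hl0 (by positivity) hα0 hβ0 hγ0
    (fun n ↦ by have := hreal n; rwa [show 2 * ν * (n : ℝ) = (2 * ν) * n by ring] at this)

end Summit.FinalStateConjecture.FinalStateConjecture.Theorems

end
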